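import Literature.Probability.RandomPlanarGeometry.SAWPulledLargeForceExpansionZdHyperoctahedral
import Literature.Probability.RandomPlanarGeometry.SAWIrreducibleBridgeSpanOne
import Literature.Probability.RandomPlanarGeometry.SAWRatioLimit
import Mathlib.Algebra.Group.ForwardDiff
import HarnessLib

/-!
# FINITE DIFFERENCES IN THE DIMENSION: `Δ^u_d N(ℤ^{d+1})|_{d=0}` is the «all `u` axes used» count, so
# `2^u·u! ∣ Σ_j (−1)^{u−j} C(u,j) N(ℤ^{j+1})` — for every cost cell `N_{c,n}` and for the SAW counts `c_n(ℤ^d)`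

Topic `Literature/Probability/RandomPlanarGeometry` (continues `SAWPulledLargeForceExpansionZdHyperoctahedral.lean`: `two_pow_mul_factorial_dvd_card_allAxesClass`
(`2^u·u! ∣ F_{c,n}(u)`), with `SAWPulledLargeForceExpansionZdCostPolynomial.costCoeffZd_eq_sum_choose_mul` (`N_{c,n}(ℤ^{d+1}) = Σ_u C(d,u) F_{c,n}(u)`),
`card_allAxesClass_eq_zero`; `SAWIrreducibleBridgeSpanOne.costCoeffZd_self_succ` (`c_n(ℤ^d) = N_{n,n+1}(ℤ^{d+1})`); `SAWRatioLimit.count_one_eq_two`;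
`SAWPulledLargeForceExpansionZdEvenDimension.costCoeffZd_zero_dim_eq_zero`; and Mathlib's forward differences `fwdDiff`, `fwdDiff_iter_eq_sum_shift`,
`fwdDiff_iter_choose_zero`).

PRINTED CONTEXT (locators only). Clisby–Liang–Slade (2007) §3.3 eqs. (29)/(31) (counts decomposed by the number of dimensions explored); Madras–Slade (1993)
§1.1 eq. (1.1.8) p. 5 and Appendix C; Graham (2010) §4 (the `2^D D!` signed permutations act freely on walks of dimensionality `D`). In the binomial basis
`N(d) = Σ_u C(d,u) F(u)` the coefficient `F(u)` is the `u`-th forward difference of `d ↦ N(d)` at `0` — so the hyperoctahedral divisibility reads,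
without any reference to axis classes (lane statement, checkable on any table of counts across dimensions):

* `fwdDiff_iter_costCoeffZd_apply_zero` — `Δ^u_d N_{c,n}(ℤ^{d+1})|_{d=0} = F_{c,n}(u)`;
* ★★★ `two_pow_mul_factorial_dvd_alternating_sum_costCoeffZd` — **`2^u·u! ∣ Σ_{j=0}^{u} (−1)^{u−j} C(u,j) N_{c,n}(ℤ^{j+1})`** for all `c, n, u`;
* ★★★ `two_pow_mul_factorial_dvd_alternating_sum_count` — **`2^u·u! ∣ Σ_{j=0}^{u} (−1)^{u−j} C(u,j) c_n(ℤ^j)`** for all `n, u`;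
* ★★ `dvd_count_three_sub_count_two` — **`48 ∣ c_n(ℤ³) − 3c_n(ℤ²) + 6`** (`n ≥ 1`); ★★ `dvd_count_four_alternating` — **`384 ∣ c_n(ℤ⁴) − 4c_n(ℤ³) + 6c_n(ℤ²) − 8`**
  (`u = 2` is `8 ∣ c_n(ℤ²) − 4` of `SAWCountZdDimensionCongruence`). Numerical face (not used): `n = 3`: `150 − 108 + 6 = 48`, `392 − 600 + 216 − 8 = 0`;
  `n = 4`: `726 − 300 + 6 = 9·48`, `2696 − 2904 + 600 − 8 = 384`; `n = 5`: `3534 − 852 + 6 = 56·48`.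
[cite: ClisbyLiangSlade2007, §3.3 eqs. (29)/(31)] [cite: MadrasSlade1993, §1.1 eq. (1.1.8) p. 5; Appendix C pp. 396–397] [cite: Graham2010, Section 4]

Provenance: lane «pcv-sawmu», a-p3 g25 (2026-08-28). PURE STD, no data, no definitions.
-/

noncomputable section

open Finset
open scoped BigOperators
open Literature.Probability.LatticeModels
open Literature.Probability.RandomPlanarGeometry.SAW

namespace Literature.Probability.RandomPlanarGeometry.SAW.Zd

/-! ## §10 Finite differences in the dimension: `Δ^u N(ℤ^{•+1})(0)` is the «all u axes used» count, divisible by `2^u·u!` -/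

section FiniteDifference

/-- The `u`-th forward difference at `0` of a binomial-basis combination `d ↦ Σ_{v ∈ s} F(v)·C(d,v)` is `F(u)` (or `0` if `u ∉ s`). [folklore] -/
private theorem fwdDiff_iter_sum_mul_choose_apply_zero (s : Finset ℕ) (F : ℕ → ℤ) (u : ℕ) :
    (fwdDiff (1 : ℕ))^[u] (fun d : ℕ => ∑ v ∈ s, F v * (d.choose v : ℤ)) 0 = if u ∈ s then F u else 0 := by
  have hfun : (fun d : ℕ => ∑ v ∈ s, F v * (d.choose v : ℤ)) = ∑ v ∈ s, F v • (fun d : ℕ => (d.choose v : ℤ)) := by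
    ext d
    simp [Finset.sum_apply]
  rw [hfun, ← fwdDiff_aux.coe_fwdDiffₗ_pow, map_sum, Finset.sum_apply]
  have hterm : ∀ v ∈ s, ((fwdDiff_aux.fwdDiffₗ ℕ ℤ 1 ^ u) (F v • fun d : ℕ => (d.choose v : ℤ))) 0 =
      if u = v then F v else 0 := by
    intro v _
    rw [map_zsmul, Pi.smul_apply, fwdDiff_aux.coe_fwdDiffₗ_pow, fwdDiff_iter_choose_zero, smul_eq_mul]
    split_ifs <;> simp
  rw [Finset.sum_congr rfl hterm, Finset.sum_ite_eq]

/-- ★★ **`Δ^u_d N_{c,n}(ℤ^{d+1}) |_{d=0} = F_{c,n}(u)`**: the `u`-th finite difference in the dimension, at dimension `0`, of the cost census is the number of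
cost-`c`, length-`n` irreducible bridges of `ℤ^{u+1}` using every lateral axis. [cite: MadrasSlade1993, §1.1 eq. (1.1.8) p. 5] [cite: Graham2010, Section 4] -/
theorem fwdDiff_iter_costCoeffZd_apply_zero (c n u : ℕ) :
    (fwdDiff (1 : ℕ))^[u] (fun d : ℕ => (costCoeffZd d c n : ℤ)) 0 =
      (((irreducibleBridges (u + 1) n).filter fun (ω : ℕ → Site (u + 1)) => costZd u n ω = c ∧
        ∀ a : Fin (u + 1), a ≠ 0 → ∃ i ≤ n, ω i a ≠ (0 : ℤ)).card : ℤ) := by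
  have h : (fun d : ℕ => (costCoeffZd d c n : ℤ)) = fun d : ℕ => ∑ v ∈ Finset.range (c + 1),
      (((irreducibleBridges (v + 1) n).filter fun (ω : ℕ → Site (v + 1)) => costZd v n ω = c ∧
        ∀ a : Fin (v + 1), a ≠ 0 → ∃ i ≤ n, ω i a ≠ (0 : ℤ)).card : ℤ) * (d.choose v : ℤ) := by
    ext d
    rw [costCoeffZd_eq_sum_choose_mul]
    push_cast
    exact Finset.sum_congr rfl fun v _ => mul_comm _ _
  rw [h, fwdDiff_iter_sum_mul_choose_apply_zero]
  split_ifs with hu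
  · rfl
  · rw [card_allAxesClass_eq_zero (by simpa [Finset.mem_range, Nat.lt_succ_iff] using hu), Nat.cast_zero]

/-- ★★★ **`2^u·u!` DIVIDES THE `u`-TH DIMENSION DIFFERENCE OF EVERY COST CELL**: for all `c, n, u`,
`2^u·u! ∣ Σ_{j=0}^{u} (−1)^{u−j} C(u,j) · N_{c,n}(ℤ^{j+1})`. [cite: MadrasSlade1993, §1.1 eq. (1.1.8) p. 5] [cite: Graham2010, Section 4] -/
theorem two_pow_mul_factorial_dvd_alternating_sum_costCoeffZd (c n u : ℕ) :
    ((2 ^ u * u.factorial : ℕ) : ℤ) ∣ ∑ j ∈ Finset.range (u + 1), (-1 : ℤ) ^ (u - j) * (u.choose j : ℤ) * (costCoeffZd j c n : ℤ) := by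
  have h := fwdDiff_iter_eq_sum_shift (1 : ℕ) (fun d : ℕ => (costCoeffZd d c n : ℤ)) u 0
  rw [fwdDiff_iter_costCoeffZd_apply_zero] at h
  have hsum : ∑ j ∈ Finset.range (u + 1), (-1 : ℤ) ^ (u - j) * (u.choose j : ℤ) * (costCoeffZd j c n : ℤ) =
      (((irreducibleBridges (u + 1) n).filter fun (ω : ℕ → Site (u + 1)) => costZd u n ω = c ∧
        ∀ a : Fin (u + 1), a ≠ 0 → ∃ i ≤ n, ω i a ≠ (0 : ℤ)).card : ℤ) := by
    rw [h]
    refine Finset.sum_congr rfl fun j _ => ?_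
    simp [smul_eq_mul, mul_assoc]
  rw [hsum]
  exact_mod_cast two_pow_mul_factorial_dvd_card_allAxesClass u c n

/-- ★★★ **`2^u·u!` DIVIDES THE `u`-TH DIMENSION DIFFERENCE OF THE SAW COUNTS**: for all `n, u`,
**`2^u·u! ∣ Σ_{j=0}^{u} (−1)^{u−j} C(u,j) · c_n(ℤ^j)`** — the `u`-th finite difference of `d ↦ c_n(ℤ^d)` at `d = 0` is the number of `n`-step
self-avoiding walks of `ℤ^u` using all `u` axes, on which the `2^u u!` signed permutations of the axes act freely.
[cite: ClisbyLiangSlade2007, §3.3 eqs. (29)/(31)] [cite: MadrasSlade1993, §1.1 eq. (1.1.8) p. 5] [cite: Graham2010, Section 4] -/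
theorem two_pow_mul_factorial_dvd_alternating_sum_count (n u : ℕ) :
    ((2 ^ u * u.factorial : ℕ) : ℤ) ∣ ∑ j ∈ Finset.range (u + 1), (-1 : ℤ) ^ (u - j) * (u.choose j : ℤ) * (count j n : ℤ) := by
  have h := two_pow_mul_factorial_dvd_alternating_sum_costCoeffZd n (n + 1) u
  simpa only [costCoeffZd_self_succ] using h

/-- `c_n(ℤ⁰) = 0` for `n ≥ 1` (no step is possible in dimension `0`). [folklore] -/
private theorem count_zero_dim_fd {n : ℕ} (hn : 1 ≤ n) : count 0 n = 0 := by
  rw [← costCoeffZd_self_succ, costCoeffZd_zero_dim_eq_zero hn]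

/-- ★★ `u = 3`: **`48 ∣ c_n(ℤ³) − 3·c_n(ℤ²) + 6`** for every `n ≥ 1` (`n = 3`: `150 − 108 + 6 = 48`; `n = 4`: `726 − 300 + 6 = 432 = 9·48`;
`n = 5`: `3534 − 852 + 6 = 2688 = 56·48`). (`u = 2` is `8 ∣ c_n(ℤ²) − 4`, `SAWCountZdDimensionCongruence`.) [cite: MadrasSlade1993, §1.1 eq. (1.1.8) p. 5;
Appendix C (exact enumerations)] -/
theorem dvd_count_three_sub_count_two {n : ℕ} (hn : 1 ≤ n) : (48 : ℤ) ∣ (count 3 n : ℤ) - 3 * count 2 n + 6 := by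
  have h := two_pow_mul_factorial_dvd_alternating_sum_count n 3
  rw [Finset.sum_range_succ, Finset.sum_range_succ, Finset.sum_range_succ, Finset.sum_range_one,
    count_zero_dim_fd hn, count_one_eq_two hn] at h
  norm_num [Nat.choose, Nat.factorial] at h
  have e : (count 3 n : ℤ) - 3 * count 2 n + 6 = 6 + -(3 * (count 2 n : ℤ)) + count 3 n := by ring
  rw [e]
  exact h

/-- ★★ `u = 4`: **`384 ∣ c_n(ℤ⁴) − 4·c_n(ℤ³) + 6·c_n(ℤ²) − 8`** for every `n ≥ 1` (`n = 4`: `2696 − 2904 + 600 − 8 = 384`; `n = 3`: `392 − 600 + 216 − 8 = 0`).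
[cite: MadrasSlade1993, §1.1 eq. (1.1.8) p. 5; Appendix C (exact enumerations)] -/
theorem dvd_count_four_alternating {n : ℕ} (hn : 1 ≤ n) :
    (384 : ℤ) ∣ (count 4 n : ℤ) - 4 * count 3 n + 6 * count 2 n - 8 := by
  have h := two_pow_mul_factorial_dvd_alternating_sum_count n 4
  rw [Finset.sum_range_succ, Finset.sum_range_succ, Finset.sum_range_succ, Finset.sum_range_succ, Finset.sum_range_one,
    count_zero_dim_fd hn, count_one_eq_two hn] at h
  norm_num [Nat.choose, Nat.factorial] at h
  have e : (count 4 n : ℤ) - 4 * count 3 n + 6 * count 2 n - 8 = -8 + 6 * (count 2 n : ℤ) + -(4 * (count 3 n : ℤ)) + count 4 n := by ring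
  rw [e]
  exact h

end FiniteDifference

end Literature.Probability.RandomPlanarGeometry.SAW.Zd

end
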